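import Summits.AtomisticToContinuum.Crystallization.Theses.FreeSplittingCertificates
import Summits.AtomisticToContinuum.Crystallization.Theorems.FreeSplittingCertificatesShellRigidityHcpStubCovering
import Summits.AtomisticToContinuum.Crystallization.Theorems.FreeSplittingCertificatesShellRigidityHcpStubNormFacts
import Summits.AtomisticToContinuum.Crystallization.Theorems.FreeSplittingCertificatesShellRigidityHcpStubShellIdentification
import Summits.AtomisticToContinuum.Crystallization.Theorems.FreeSplittingCertificatesShellRigidityHcpStubEmptyZone
import Summits.AtomisticToContinuum.Crystallization.Theorems.FreeSplittingCertificatesShellRigidityHcpStubLimitShell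
import Summits.AtomisticToContinuum.Crystallization.Theorems.FreeSplittingCertificatesShellRigidityHcpStubWindowTransfer
import Summits.AtomisticToContinuum.Crystallization.Theorems.FreeSplittingCertificatesShellRigidityHcpStubMain

/-!
# Route FreeSplittingCertificates — crux `ShellRigidityHcp` (stmt-AtomisticToContinuum-12561), proved

Closing file of line `birth` (registered seven-stub skeleton `Cruxes/ShellRigidityHcp/Lines/birth.lean`):
`shellRigidityHcp_proof : ShellRigidityHcp` composes the seven landed stubs of namespace
`Summit.AtomisticToContinuum.Crystallization.Theorems.ShellRigidityHcpBirth` BY NAME — nothing is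
re-declared here:

* `stub_covering` — 45° covering radius of the anticuboctahedron directions (for every linear isometry);
* `stub_normFacts` — the stretched shell `S(a,t) = hcpKissingPattern.image (u ↦ a•(u + (t(u₀+u₁+u₂)/3)•(1,1,1)))`
  has norms in `(0.99a, 1.01a)` and displacement `≤ a/100`;
* `stub_shellIdentification` — a linear isometry carries `S(a,t)` onto the punctured `13/10 a`-cluster of
  the origin in `hcpStacking a ((1+t)a√(2/3))`;
* `stub_emptyZone` — two constrained sites are never at distance in `(5a/4, 4a/3]`;
* `stub_limitShell` — the one-step local-limit lemma (closed `5a/4`-shell of an approximant ⇒ open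
  `13/10 a`-cluster of the limit point, `(η + 2ε)`-close by a bijection);
* `stub_windowTransfer` — a `BallMatch` against `g '' Λ` is the crux's two-sided window matching against
  `A (Λ − q)`;
* `stub_main` — the compactness upgrade (local matching compactness of `δ`-separated sets,
  `exists_subseq_forall_eventually_ballMatch`, and the tree's exact local theorem
  `ExactHcpLocal.eq_image_hcpStacking` off the ideal ratio).

The periodic configuration is `P := hcpPeriodicConfiguration` with in-layer spacing `a` and layer spacing
`(1+t)·a·√(2/3)` (nonzero since `|t| ≤ 1/100`), whose point set is the stretched hcp stacking
(`hcpPeriodicConfiguration_points`). Sources: Hales, *Dense Sphere Packings* §1.3 (layer rigidity; tree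
`HalesDSP_layerPackings_holds`, `ExactHcpLocal.*`); Baake–Grimm, *Aperiodic Order* I, Remark 5.6 (local rubber
topology; tree `LocalMatchingCompactness`). All bookkeeping `[folklore]`.
-/

noncomputable section

namespace Summit.AtomisticToContinuum.Crystallization.Theorems

open Literature.Geometry.DiscreteGeometry Literature.MathematicalPhysics.StatisticalMechanics
open Summit.AtomisticToContinuum.Crystallization.Theorems.ShellRigidityHcpBirth

/-- **Crux `ShellRigidityHcp` (stmt-AtomisticToContinuum-12561) of route FreeSplittingCertificates, by
name.** For every `a > 0` and `|t| ≤ 1/100` there is a periodic configuration `P` (the stretched hcp crystal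
`hcpPeriodicConfiguration a ((1+t)a√(2/3))`) such that for all `δ, R', ε' > 0` there are `η > 0` and `L` with:
in any finite `δ`-separated configuration, a site all of whose neighbours within `L` have first shells
(radius `5a/4`) `η`-close to `S(a,t)` has its `R'`-window two-sidedly `ε'`-matched to `x i + A (P.points − q)`
for some `q ∈ P.points` and a linear isometry `A`. Composition of the seven stubs of line `birth`.
[folklore] -/
theorem shellRigidityHcp_proof :
    Summit.AtomisticToContinuum.Crystallization.Theses.FreeSplittingCertificates.ShellRigidityHcp := by
  unfold Summit.AtomisticToContinuum.Crystallization.Theses.FreeSplittingCertificates.ShellRigidityHcp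
  intro a t ha ht
  have h1t : (0 : ℝ) < 1 + t := by
    have := (abs_le.mp ht).1
    linarith
  have hh : (1 + t) * a * Real.sqrt (2 / 3) ≠ 0 :=
    (mul_pos (mul_pos h1t ha) (Real.sqrt_pos.mpr (by norm_num))).ne'
  refine ⟨hcpPeriodicConfiguration ha.ne' hh, ?_⟩
  intro δ R' ε' hδ hR' hε'
  obtain ⟨η, hη, L, hL⟩ :=
    stub_main a t ha ht (stub_shellIdentification a t ha ht)
      (fun η hη => stub_emptyZone stub_covering stub_normFacts a t η ha ht hη)
      stub_limitShell stub_windowTransfer δ R' ε' hδ hR' hε'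
  refine ⟨η, hη, L, ?_⟩
  intro N x hsep i hshell
  rw [hcpPeriodicConfiguration_points]
  exact hL N x hsep i hshell

end Summit.AtomisticToContinuum.Crystallization.Theorems

end
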